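import Literature.Order.Ordinal.NaturalSum
import Mathlib.SetTheory.Ordinal.Principal
import HarnessLib

/-!
# The Brookfield sum is the Hessenberg sum: `⊕` through the Cantor normal form (Clark 2015, §1.2, Thm. 3)

Topic `Literature/Order/Ordinal`, namespace `Literature.Order.Ordinal`.  THEOREMS ONLY (no `def`, no instance, no named
fact), all proved, on top of `NaturalSum.lean` (the tree's `nadd α β = α ⊕ β`, DEFINED by the Brookfield–Clark recursion
«the least ordinal exceeding all `α′ ⊕ β` and all `α ⊕ β′`», i.e. `α ⊕_B β = len((α + 1) × (β + 1))`, see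
`BrookfieldLengthFunction.lean`).  This file proves Clark's **Theorem 3**, `α ⊕_B β = α ⊕_H β`, where `⊕_H` is
Hessenberg's natural sum DEFINED by adding Cantor normal forms coefficientwise — for ALL ordinals (the tree had it below
`ω²` only, `NaturalSumOmegaMultiples.lean`), resolving the `TODO(general form)` recorded there and in `NaturalSum.lean`.

## Source (read at the page)

P. L. Clark, *A note on Euclidean order types*, Order **32** (2015) 157–178 [Clark2015EuclideanOrderTypes] (materialised
`paper:arxiv-1208.0977`, p0003), §1.2, VERBATIM: «We recall the following, a version of the Cantor normal form: for any
`α, β ∈ Ord` there are `γ₁, …, γ_r ∈ Ord`, `r ∈ ℤ⁺` and `m₁, …, m_r, n₁, …, n_r ∈ ℕ` with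
`α = m₁ω^{γ₁} + … + m_rω^{γ_r}`, `β = n₁ω^{γ₁} + … + n_rω^{γ_r}` (here `γ₁ > … > γ_r`). … We may then define the
Hessenberg sum `α ⊕_H β = (m₁ + n₁)ω^{γ₁} + … + (m_r + n_r)ω^{γ_r}`.  **Theorem 3.** For all `α, β ∈ Ord`,
`α ⊕_B β = α ⊕_H β`.  Proof. See [Brookfield02].»  (Clark writes `mω^γ` for the ordinal product `ω^γ · m`.)

## What is formalised

* §1 `add_nadd_le` — `γ + (x ⊕ y) ≤ (γ + x) ⊕ y`, and `add_add_nadd_le` — `p + q + (x ⊕ y) ≤ (p + x) ⊕ (q + y)`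
  (the natural sum dominates shifted ordinal sums; the lower-bound half of Thm. 3).
* §2 `lt_opow_mul_natCast_add_iff` — the ordinals below `ω^γ·a + x` are the `ω^γ·i + x′` (`i < a`, `x′ < ω^γ`) and the
  `ω^γ·a + x′` (`x′ < x`) — the case analysis of the recursion.
* §3 **`nadd_opow_mul_natCast_add`** — THE BLOCK FORMULA OF THEOREM 3: for `x, y < ω^γ` and `a, b ∈ ℕ`,
  `(ω^γ·a + x) ⊕ (ω^γ·b + y) = ω^γ·(a + b) + (x ⊕ y)` (transfinite induction on `γ`, inside it induction on `a + b` and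
  on `(x, y)` through the recursion `nadd_le_iff`); with it `isPrincipal_nadd_omega0_opow` — `ω^γ` IS `⊕`-CLOSED
  (`x, y < ω^γ ⟹ x ⊕ y < ω^γ`), `nadd_opow_mul_natCast` (`ω^γ·a ⊕ ω^γ·b = ω^γ·(a + b)`), and the absorption
  `nadd_opow_mul_natCast_add_of_lt` (`(ω^γ·a + x) ⊕ y = ω^γ·a + (x ⊕ y)` for `y < ω^γ`).
* §4 **`nadd_cnf`** — THEOREM 3 AS PRINTED: for a list of exponents `γ₁ > … > γ_r` with coefficient pairs `(mᵢ, nᵢ)`,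
  `(Σ ω^{γᵢ}·mᵢ) ⊕ (Σ ω^{γᵢ}·nᵢ) = Σ ω^{γᵢ}·(mᵢ + nᵢ)`; `exists_common_cnf` — Clark's «version of the Cantor normal
  form» (any two ordinals have Cantor normal forms over a common strictly decreasing list of exponents, zero
  coefficients allowed); and the headline **`nadd_eq_hessenbergSum`** — for all `α, β` there is such a common normal form
  and `α ⊕ β` is the coefficientwise sum.
The lists are plain `List (Ordinal × ℕ × ℕ)` (exponent, coefficient of `α`, coefficient of `β`) evaluated by `List.foldr`,
as Mathlib's `Ordinal.CNF` is; strict decrease of exponents is `List.Pairwise`.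

## Mathlib / tree search

Mathlib (this pin) has no `Ordinal.nadd` / `NaturalOps` (see `NaturalSum.lean`); used: `WellFoundedLT.induction`,
`Ordinal.lt_mul_iff_div_lt`, `Ordinal.div_add_mod`, `Ordinal.mod_lt`, `Ordinal.lt_omega0`, `Ordinal.add_sub_cancel_of_le`,
`Ordinal.lt_omega0_opow`, `Ordinal.opow_mul_lt_opow`, `Ordinal.isPrincipal_add_omega0_opow`, `Ordinal.opow_log_le_self`,
`Ordinal.lt_opow_succ_log_self`, `Ordinal.IsPrincipal`.  Tree: `NaturalSum.lean` (`nadd_le_iff`, `lt_nadd_iff`,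
`nadd_lt_nadd_left/right`, `nadd_le_nadd`, `nadd_comm`, `nadd_zero`, `le_nadd_self`), `NaturalSumOmegaMultiples.lean`
(the case `γ ∈ {0, 1}`: `nadd_omega0_mul_add_natCast`), `BrookfieldLengthFunction.lean` (`⊕ = len((α+1)×(β+1))`,
`nadd_assoc`).
-/

namespace Literature.Order.Ordinal

open _root_.Ordinal _root_.Order

universe u

/-! ## §1 The natural sum dominates shifted ordinal sums -/

/-- **`γ + (x ⊕ y) ≤ (γ + x) ⊕ y`**: prefixing an ordinal summand to one argument of a natural sum costs at least the
same prefix (induction on `(x, y)` through the recursion: below `γ + (x ⊕ y)` lie the ordinals `< γ ≤ γ + x` and the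
`γ + w`, `w < x ⊕ y`, i.e. `w ≤ x′ ⊕ y` or `w ≤ x ⊕ y′`).  Half of the comparison `⊕_H ≤ ⊕_B` in Thm. 3.
[cite: Clark2015EuclideanOrderTypes, §1.2 Thm. 3 (lower bound half)] -/
theorem add_nadd_le (c : Ordinal.{u}) : ∀ x y : Ordinal.{u}, c + nadd x y ≤ nadd (c + x) y := by
  intro x
  induction x using WellFoundedLT.induction with
  | _ x ihx =>
  intro y
  induction y using WellFoundedLT.induction with
  | _ y ihy =>
  refine le_of_forall_lt fun z hz => ?_
  rcases lt_or_ge z c with hzc | hzc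
  · exact hzc.trans_le (le_self_add.trans (le_nadd_self _ _))
  · have hzw : z = c + (z - c) := (Ordinal.add_sub_cancel_of_le hzc).symm
    rw [hzw] at hz ⊢
    have hw : z - c < nadd x y := (add_lt_add_iff_left c).1 hz
    rcases lt_nadd_iff.1 hw with ⟨x', hx', hle⟩ | ⟨y', hy', hle⟩
    · calc c + (z - c) ≤ c + nadd x' y := add_le_add_right hle _
        _ ≤ nadd (c + x') y := ihx x' hx' y
        _ < nadd (c + x) y := nadd_lt_nadd_right ((add_lt_add_iff_left c).2 hx') y
    · calc c + (z - c) ≤ c + nadd x y' := add_le_add_right hle _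
        _ ≤ nadd (c + x) y' := ihy y' hy'
        _ < nadd (c + x) y := nadd_lt_nadd_left hy' _

/-- `γ + (x ⊕ y) ≤ x ⊕ (γ + y)` (the symmetric form). [cite: Clark2015EuclideanOrderTypes, §1.2 Thm. 3 (lower bound half)] -/
theorem add_nadd_le' (c x y : Ordinal.{u}) : c + nadd x y ≤ nadd x (c + y) := by
  rw [nadd_comm x y, nadd_comm x (c + y)]
  exact add_nadd_le c y x

/-- **`p + q + (x ⊕ y) ≤ (p + x) ⊕ (q + y)`** — with `p = ω^γ·a`, `q = ω^γ·b` this is `⊕_H ≤ ⊕_B` blockwise.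
[cite: Clark2015EuclideanOrderTypes, §1.2 Thm. 3 (lower bound half)] -/
theorem add_add_nadd_le (p q x y : Ordinal.{u}) : p + q + nadd x y ≤ nadd (p + x) (q + y) :=
  calc p + q + nadd x y = p + (q + nadd x y) := add_assoc _ _ _
    _ ≤ p + nadd x (q + y) := add_le_add_right (add_nadd_le' q x y) _
    _ ≤ nadd (p + x) (q + y) := add_nadd_le p x (q + y)

/-! ## §2 The ordinals below `ω^γ·a + x` -/

/-- **Case analysis below a Cantor-normal-form block**: for a natural number `a`, `z < ω^γ·a + x` iff
`z = ω^γ·i + x′` with `i < a`, `x′ < ω^γ`, or `z = ω^γ·a + x′` with `x′ < x` (division with remainder by `ω^γ`).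
[cite: Clark2015EuclideanOrderTypes, §1.2 («a version of the Cantor normal form»)] -/
theorem lt_opow_mul_natCast_add_iff {e x z : Ordinal.{u}} {a : ℕ} :
    z < ω ^ e * a + x ↔
      (∃ i : ℕ, i < a ∧ ∃ x' < ω ^ e, z = ω ^ e * i + x') ∨ ∃ x' < x, z = ω ^ e * a + x' := by
  have h0 : (ω : Ordinal.{u}) ^ e ≠ 0 := (opow_pos e omega0_pos).ne'
  constructor
  · intro hz
    by_cases hza : z < ω ^ e * a
    · left
      have hq : z / ω ^ e < (a : Ordinal.{u}) := (Ordinal.lt_mul_iff_div_lt h0).1 hza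
      obtain ⟨i, hi⟩ := Ordinal.lt_omega0.1 (hq.trans (natCast_lt_omega0 a))
      refine ⟨i, ?_, z % ω ^ e, Ordinal.mod_lt z h0, ?_⟩
      · rw [hi] at hq
        exact_mod_cast hq
      · rw [← hi, Ordinal.div_add_mod]
    · right
      push Not at hza
      refine ⟨z - ω ^ e * a, ?_, (Ordinal.add_sub_cancel_of_le hza).symm⟩
      rwa [← Ordinal.add_sub_cancel_of_le hza, add_lt_add_iff_left] at hz
  · rintro (⟨i, hi, x', hx', rfl⟩ | ⟨x', hx', rfl⟩)
    · calc ω ^ e * i + x' < ω ^ e * i + ω ^ e := (add_lt_add_iff_left _).2 hx'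
        _ = ω ^ e * ((i + 1 : ℕ) : Ordinal.{u}) := by rw [Nat.cast_succ, mul_add_one]
        _ ≤ ω ^ e * a := mul_le_mul_right (by exact_mod_cast hi) _
        _ ≤ ω ^ e * a + x := le_self_add
    · exact (add_lt_add_iff_left _).2 hx'

/-! ## §3 The block formula `(ω^γ·a + x) ⊕ (ω^γ·b + y) = ω^γ·(a + b) + (x ⊕ y)` -/

/-- `ω^γ` is `⊕`-closed as soon as `ω^{γ′}·n ⊕ ω^{γ′}·n = ω^{γ′}·2n` for all `γ′ < γ` (the bootstrap of the induction
on `γ`: `x, y < ω^γ` lie below a common `ω^{γ′}·n`, `γ′ < γ`, by `Ordinal.lt_omega0_opow`).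
[cite: Clark2015EuclideanOrderTypes, §1.2 Thm. 3 (proof structure)] -/
theorem nadd_lt_opow_of_forall_lt {e : Ordinal.{u}}
    (H : ∀ e' < e, ∀ n : ℕ, nadd (ω ^ e' * n : Ordinal.{u}) (ω ^ e' * n) = ω ^ e' * ((n + n : ℕ) : Ordinal.{u}))
    {x y : Ordinal.{u}} (hx : x < ω ^ e) (hy : y < ω ^ e) : nadd x y < ω ^ e := by
  rcases eq_or_ne e 0 with rfl | he
  · rw [opow_zero, Order.lt_one_iff] at hx hy ⊢
    rw [hx, hy, nadd_zero]
  · obtain ⟨c₁, hc₁, n₁, hn₁⟩ := (lt_omega0_opow he).1 hx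
    obtain ⟨c₂, hc₂, n₂, hn₂⟩ := (lt_omega0_opow he).1 hy
    -- a common bound `ω^c·n`, `c = max c₁ c₂ < e`, `n = n₁ + n₂`
    set c := max c₁ c₂ with hc
    have hce : c < e := max_lt hc₁ hc₂
    have hx' : x ≤ ω ^ c * ((n₁ + n₂ : ℕ) : Ordinal.{u}) := hn₁.le.trans <|
      (mul_le_mul_left (opow_le_opow_right omega0_pos (le_max_left _ _)) _).trans
        (mul_le_mul_right (by exact_mod_cast Nat.le_add_right n₁ n₂) _)
    have hy' : y ≤ ω ^ c * ((n₁ + n₂ : ℕ) : Ordinal.{u}) := hn₂.le.trans <|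
      (mul_le_mul_left (opow_le_opow_right omega0_pos (le_max_right _ _)) _).trans
        (mul_le_mul_right (by exact_mod_cast Nat.le_add_left n₂ n₁) _)
    calc nadd x y ≤ nadd (ω ^ c * ((n₁ + n₂ : ℕ) : Ordinal.{u})) (ω ^ c * ((n₁ + n₂ : ℕ) : Ordinal.{u})) :=
          nadd_le_nadd hx' hy'
      _ = ω ^ c * ((n₁ + n₂ + (n₁ + n₂) : ℕ) : Ordinal.{u}) := H c hce _
      _ < ω ^ e := opow_mul_lt_opow (natCast_lt_omega0 _) hce

/-- **Theorem 3, the block formula (Hessenberg's coefficientwise addition): for `x, y < ω^γ` and natural numbers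
`a, b`, `(ω^γ·a + x) ⊕ (ω^γ·b + y) = ω^γ·(a + b) + (x ⊕ y)`.**  Proof: `≥` is `add_add_nadd_le`; `≤` through the
recursion — an ordinal below `ω^γ·a + x` is `ω^γ·i + x′` (`i < a`, `x′ < ω^γ`), whose natural sum with `ω^γ·b + y` is
`ω^γ·(i + b) + (x′ ⊕ y) < ω^γ·(i + b + 1) ≤ ω^γ·(a + b)` by induction on `a + b` and `⊕`-closedness of `ω^γ`
(induction on `γ`), or `ω^γ·a + x′` (`x′ < x`), handled by induction on `x`; symmetrically in the second argument.
[cite: Clark2015EuclideanOrderTypes, §1.2 Thm. 3] -/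
theorem nadd_opow_mul_natCast_add (e : Ordinal.{u}) (a b : ℕ) {x y : Ordinal.{u}} (hx : x < ω ^ e) (hy : y < ω ^ e) :
    nadd (ω ^ e * a + x) (ω ^ e * b + y) = ω ^ e * ((a + b : ℕ) : Ordinal.{u}) + nadd x y := by
  induction e using WellFoundedLT.induction generalizing a b x y with
  | _ e ihe =>
  -- `ω^e` is `⊕`-closed, from the formula at smaller exponents
  have closed : ∀ {x y : Ordinal.{u}}, x < ω ^ e → y < ω ^ e → nadd x y < ω ^ e := fun hx hy =>
    nadd_lt_opow_of_forall_lt (fun e' he' n => by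
      simpa only [add_zero, nadd_zero] using ihe e' he' n n (opow_pos e' omega0_pos) (opow_pos e' omega0_pos)) hx hy
  -- the step bound `ω^e·(i + b′) + w < ω^e·(a′ + b′)` for `i < a′`, `w < ω^e`
  have step : ∀ (i a' b' : ℕ) {w : Ordinal.{u}}, i < a' → w < ω ^ e →
      ω ^ e * ((i + b' : ℕ) : Ordinal.{u}) + w < ω ^ e * ((a' + b' : ℕ) : Ordinal.{u}) := by
    intro i a' b' w hi hw
    calc ω ^ e * ((i + b' : ℕ) : Ordinal.{u}) + w
        < ω ^ e * ((i + b' : ℕ) : Ordinal.{u}) + ω ^ e := (add_lt_add_iff_left _).2 hw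
      _ = ω ^ e * ((i + b' + 1 : ℕ) : Ordinal.{u}) := by rw [Nat.cast_succ, mul_add_one]
      _ ≤ ω ^ e * ((a' + b' : ℕ) : Ordinal.{u}) :=
          mul_le_mul_right (by exact_mod_cast (by omega : i + b' + 1 ≤ a' + b')) _
  -- induction on `a + b`, then on `x`, then on `y`
  suffices H : ∀ N : ℕ, ∀ a b : ℕ, a + b = N → ∀ x y : Ordinal.{u}, x < ω ^ e → y < ω ^ e →
      nadd (ω ^ e * a + x) (ω ^ e * b + y) = ω ^ e * ((a + b : ℕ) : Ordinal.{u}) + nadd x y from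
    H _ a b rfl x y hx hy
  intro N
  induction N using Nat.strong_induction_on with
  | _ N ihN =>
  intro a b hab x
  induction x using WellFoundedLT.induction with
  | _ x ihx =>
  intro y
  induction y using WellFoundedLT.induction with
  | _ y ihy =>
  intro hx hy
  apply le_antisymm
  · rw [nadd_le_iff]
    constructor
    · intro z hz
      rcases lt_opow_mul_natCast_add_iff.1 hz with ⟨i, hi, x', hx', rfl⟩ | ⟨x', hx'x, rfl⟩
      · rw [ihN (i + b) (by omega) i b rfl x' y hx' hy]
        exact (step i a b hi (closed hx' hy)).trans_le le_self_add
      · rw [ihx x' hx'x y (hx'x.trans hx) hy]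
        exact (add_lt_add_iff_left _).2 (nadd_lt_nadd_right hx'x y)
    · intro z hz
      rcases lt_opow_mul_natCast_add_iff.1 hz with ⟨j, hj, y', hy', rfl⟩ | ⟨y', hy'y, rfl⟩
      · rw [ihN (a + j) (by omega) a j rfl x y' hx hy', Nat.add_comm a j, Nat.add_comm a b]
        exact (step j b a hj (closed hx hy')).trans_le le_self_add
      · rw [ihy y' hy'y hx (hy'y.trans hy)]
        exact (add_lt_add_iff_left _).2 (nadd_lt_nadd_left hy'y _)
  · calc ω ^ e * ((a + b : ℕ) : Ordinal.{u}) + nadd x y = ω ^ e * a + ω ^ e * b + nadd x y := by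
          rw [Nat.cast_add, mul_add]
      _ ≤ nadd (ω ^ e * a + x) (ω ^ e * b + y) := add_add_nadd_le _ _ _ _

/-- **`ω^γ·a ⊕ ω^γ·b = ω^γ·(a + b)`** (Thm. 3 with a single exponent). [cite: Clark2015EuclideanOrderTypes, §1.2 Thm. 3] -/
theorem nadd_opow_mul_natCast (e : Ordinal.{u}) (a b : ℕ) :
    nadd (ω ^ e * a : Ordinal.{u}) (ω ^ e * b) = ω ^ e * ((a + b : ℕ) : Ordinal.{u}) := by
  simpa only [add_zero, nadd_zero] using
    nadd_opow_mul_natCast_add e a b (opow_pos e omega0_pos) (opow_pos e omega0_pos)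

/-- **`ω^γ` is closed under the natural sum**: `x, y < ω^γ ⟹ x ⊕ y < ω^γ` (the additively indecomposable ordinals are
`⊕`-indecomposable; immediate from Thm. 3, the leading exponent of `x ⊕_H y` being `max` of those of `x`, `y`).
[cite: Clark2015EuclideanOrderTypes, §1.2 Thm. 3 (consequence)] -/
theorem isPrincipal_nadd_omega0_opow (e : Ordinal.{u}) : IsPrincipal nadd (ω ^ e : Ordinal.{u}) :=
  fun _ _ hx hy => nadd_lt_opow_of_forall_lt (fun e' _ n => nadd_opow_mul_natCast e' n n) hx hy

/-- `x, y < ω^γ ⟹ x ⊕ y < ω^γ` (explicit form of `isPrincipal_nadd_omega0_opow`).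
[cite: Clark2015EuclideanOrderTypes, §1.2 Thm. 3 (consequence)] -/
theorem nadd_lt_omega0_opow {e x y : Ordinal.{u}} (hx : x < ω ^ e) (hy : y < ω ^ e) : nadd x y < ω ^ e :=
  isPrincipal_nadd_omega0_opow e hx hy

/-- **Absorption**: for `x, y < ω^γ`, `(ω^γ·a + x) ⊕ y = ω^γ·a + (x ⊕ y)` (Thm. 3 with `b = 0`: a summand all of whose
exponents are smaller passes through the leading block). [cite: Clark2015EuclideanOrderTypes, §1.2 Thm. 3] -/
theorem nadd_opow_mul_natCast_add_of_lt (e : Ordinal.{u}) (a : ℕ) {x y : Ordinal.{u}} (hx : x < ω ^ e)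
    (hy : y < ω ^ e) : nadd (ω ^ e * a + x) y = ω ^ e * a + nadd x y := by
  have h := nadd_opow_mul_natCast_add e a 0 hx hy
  rwa [Nat.cast_zero, mul_zero, zero_add, Nat.add_zero] at h

/-- The single-term case `ω^γ ⊕ ω^γ = ω^γ·2`. [cite: Clark2015EuclideanOrderTypes, §1.2 Thm. 3] -/
theorem nadd_omega0_opow_self (e : Ordinal.{u}) : nadd (ω ^ e : Ordinal.{u}) (ω ^ e) = ω ^ e * 2 := by
  have h := nadd_opow_mul_natCast e 1 1
  rwa [Nat.cast_one, mul_one, Nat.cast_add, Nat.cast_one, one_add_one_eq_two] at h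

/-! ## §4 Theorem 3 as printed: Cantor normal forms over a common list of exponents -/

/-- A sum `Σ ω^{γᵢ}·cᵢ` (natural coefficients) all of whose exponents are `< γ` is `< ω^γ` (`ω^γ` is additively
principal, `Ordinal.isPrincipal_add_omega0_opow`). [cite: Clark2015EuclideanOrderTypes, §1.2 («a version of the Cantor normal form»)] -/
theorem foldr_opow_mul_lt_opow {e : Ordinal.{u}} (c : Ordinal.{u} × ℕ × ℕ → ℕ) :
    ∀ l : List (Ordinal.{u} × ℕ × ℕ), (∀ p ∈ l, p.1 < e) →
      l.foldr (fun p acc => ω ^ p.1 * (c p : Ordinal.{u}) + acc) 0 < ω ^ e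
  | [], _ => by simpa using opow_pos e omega0_pos
  | p :: t, h => by
    rw [List.foldr_cons]
    exact isPrincipal_add_omega0_opow e
      (opow_mul_lt_opow (natCast_lt_omega0 _) (h p (by simp)))
      (foldr_opow_mul_lt_opow c t fun q hq => h q (by simp [hq]))

/-- **Theorem 3 (Clark 2015 / Brookfield 2002), `α ⊕_B β = α ⊕_H β`, as printed**: if
`α = ω^{γ₁}·m₁ + … + ω^{γ_r}·m_r` and `β = ω^{γ₁}·n₁ + … + ω^{γ_r}·n_r` with `γ₁ > … > γ_r` and natural coefficients
(zero allowed), then `α ⊕ β = ω^{γ₁}·(m₁ + n₁) + … + ω^{γ_r}·(m_r + n_r)` — the tree's `nadd` (the Brookfield sum) IS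
Hessenberg's coefficientwise sum.  The data is a list of triples `(γᵢ, mᵢ, nᵢ)` with strictly decreasing exponents,
evaluated by `List.foldr`. [cite: Clark2015EuclideanOrderTypes, §1.2 Thm. 3] -/
theorem nadd_cnf : ∀ l : List (Ordinal.{u} × ℕ × ℕ), l.Pairwise (fun p q => q.1 < p.1) →
    nadd (l.foldr (fun p acc => ω ^ p.1 * (p.2.1 : Ordinal.{u}) + acc) 0)
        (l.foldr (fun p acc => ω ^ p.1 * (p.2.2 : Ordinal.{u}) + acc) 0) =
      l.foldr (fun p acc => ω ^ p.1 * ((p.2.1 + p.2.2 : ℕ) : Ordinal.{u}) + acc) 0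
  | [], _ => by simp [nadd_zero]
  | p :: t, h => by
    rw [List.pairwise_cons] at h
    simp only [List.foldr_cons]
    rw [nadd_opow_mul_natCast_add p.1 p.2.1 p.2.2 (foldr_opow_mul_lt_opow (fun q => q.2.1) t h.1)
      (foldr_opow_mul_lt_opow (fun q => q.2.2) t h.1), nadd_cnf t h.2]

/-- **Clark's «version of the Cantor normal form»**: any two ordinals `α, β` have Cantor normal forms over a COMMON
strictly decreasing list of exponents `γ₁ > … > γ_r` with natural coefficients (zeros allowed):
`α = Σ ω^{γᵢ}·mᵢ`, `β = Σ ω^{γᵢ}·nᵢ`.  (Peel off the block of exponent `γ = log_ω (max α β)`: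
`α = ω^γ·(α / ω^γ) + α % ω^γ` with quotient `< ω`, and recurse below `ω^γ`.)
[cite: Clark2015EuclideanOrderTypes, §1.2 («a version of the Cantor normal form»)] -/
theorem exists_common_cnf (α β : Ordinal.{u}) : ∃ l : List (Ordinal.{u} × ℕ × ℕ),
    l.Pairwise (fun p q => q.1 < p.1) ∧
      l.foldr (fun p acc => ω ^ p.1 * (p.2.1 : Ordinal.{u}) + acc) 0 = α ∧
        l.foldr (fun p acc => ω ^ p.1 * (p.2.2 : Ordinal.{u}) + acc) 0 = β := by
  -- with an exponent bound carried along the recursion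
  suffices H : ∀ e : Ordinal.{u}, ∀ α β : Ordinal.{u}, α < ω ^ e → β < ω ^ e →
      ∃ l : List (Ordinal.{u} × ℕ × ℕ), (∀ p ∈ l, p.1 < e) ∧ l.Pairwise (fun p q => q.1 < p.1) ∧
        l.foldr (fun p acc => ω ^ p.1 * (p.2.1 : Ordinal.{u}) + acc) 0 = α ∧
          l.foldr (fun p acc => ω ^ p.1 * (p.2.2 : Ordinal.{u}) + acc) 0 = β by
    obtain ⟨l, -, hl⟩ := H (succ (log ω (max α β))) α β
      ((le_max_left α β).trans_lt (lt_opow_succ_log_self one_lt_omega0 _))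
      ((le_max_right α β).trans_lt (lt_opow_succ_log_self one_lt_omega0 _))
    exact ⟨l, hl⟩
  intro e
  induction e using WellFoundedLT.induction with
  | _ e ihe =>
  intro α β hα hβ
  by_cases h0 : max α β = 0
  · have hα0 : α = 0 := nonpos_iff_eq_zero.1 ((le_max_left α β).trans h0.le)
    have hβ0 : β = 0 := nonpos_iff_eq_zero.1 ((le_max_right α β).trans h0.le)
    exact ⟨[], by simp, List.Pairwise.nil, by simp [hα0], by simp [hβ0]⟩
  · -- the leading exponent `γ = log_ω (max α β) < e`
    set γ := log ω (max α β) with hγ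
    have hωγ : (ω : Ordinal.{u}) ^ γ ≠ 0 := (opow_pos γ omega0_pos).ne'
    have hγe : γ < e :=
      (opow_lt_opow_iff_right one_lt_omega0).1 ((opow_log_le_self ω h0).trans_lt (max_lt hα hβ))
    have hlt : max α β < ω ^ γ * ω := by
      rw [← opow_succ]; exact lt_opow_succ_log_self one_lt_omega0 _
    -- quotients are natural numbers, remainders are `< ω^γ`
    obtain ⟨a, ha⟩ := Ordinal.lt_omega0.1
      ((Ordinal.lt_mul_iff_div_lt hωγ).1 ((le_max_left α β).trans_lt hlt))
    obtain ⟨b, hb⟩ := Ordinal.lt_omega0.1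
      ((Ordinal.lt_mul_iff_div_lt hωγ).1 ((le_max_right α β).trans_lt hlt))
    obtain ⟨t, hte, htp, htα, htβ⟩ := ihe γ hγe (α % ω ^ γ) (β % ω ^ γ)
      (Ordinal.mod_lt α hωγ) (Ordinal.mod_lt β hωγ)
    refine ⟨(γ, a, b) :: t, ?_, List.pairwise_cons.2 ⟨fun q hq => hte q hq, htp⟩, ?_, ?_⟩
    · intro p hp
      rcases List.mem_cons.1 hp with rfl | hp
      · exact hγe
      · exact (hte p hp).trans hγe
    · rw [List.foldr_cons, htα, ← ha, Ordinal.div_add_mod]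
    · rw [List.foldr_cons, htβ, ← hb, Ordinal.div_add_mod]

/-- **Theorem 3 for all `α, β ∈ Ord`: `α ⊕_B β = α ⊕_H β`.**  For any two ordinals there is a common Cantor normal form
`α = Σ ω^{γᵢ}·mᵢ`, `β = Σ ω^{γᵢ}·nᵢ` (`γ₁ > … > γ_r`), and for it the Brookfield sum (the tree's `nadd`, i.e.
`len((α + 1) × (β + 1))`) is Hessenberg's `Σ ω^{γᵢ}·(mᵢ + nᵢ)`. [cite: Clark2015EuclideanOrderTypes, §1.2 Thm. 3] -/
theorem nadd_eq_hessenbergSum (α β : Ordinal.{u}) : ∃ l : List (Ordinal.{u} × ℕ × ℕ),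
    l.Pairwise (fun p q => q.1 < p.1) ∧
      l.foldr (fun p acc => ω ^ p.1 * (p.2.1 : Ordinal.{u}) + acc) 0 = α ∧
        l.foldr (fun p acc => ω ^ p.1 * (p.2.2 : Ordinal.{u}) + acc) 0 = β ∧
          nadd α β = l.foldr (fun p acc => ω ^ p.1 * ((p.2.1 + p.2.2 : ℕ) : Ordinal.{u}) + acc) 0 := by
  obtain ⟨l, hl, hα, hβ⟩ := exists_common_cnf α β
  exact ⟨l, hl, hα, hβ, by rw [← hα, ← hβ, nadd_cnf l hl]⟩

end Literature.Order.Ordinal
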